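import Literature.Probability.LatticeModels.SlitPlaneSpinorCorners
import HarnessLib

/-!
# Lemma 3.5 of Chelkak–Hongler–Izyurov in the tree's frame: the spin fermion and the explicit
# full-plane spinor have the same singularity at the source corner

Topic `Literature/Probability/LatticeModels`. CHI (Ann. of Math. 181 (2015)), Lemma 3.2:
`P_{iℝ} F_{[Ω_δ,a]}(a + (1 ± i)δ/2) = ∓ i` for the spinor observable normalised by `E[σ_a]`;
Lemma 3.5: the full-plane spinor `F_{[ℂ_δ,a]}` has the same two projections, so
`F_{[Ω_δ,a]} - F_{[ℂ_δ,a]}`, extended by `0` at `a + δ/2`, is s-holomorphic at the source.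

Tree form. The signed Kadanoff–Ceva observable `kcObs G₂ Λ η ∅ cut` of
`IsingDisorderObservable.lean` (no background spins: the one-point function) for a cut system with
`cut p₀ = ∅` at the source plaquette `p₀`, and the explicit spinor `slitFC p₀` of
`SlitPlaneSpinorCorners.lean`, both as bond functions in the frame `kcVec 0 …`:

* `frameCoord_kcObs_source`: at the source corner `(v₀, SW)`, `v₀ = p₀ + e₀ + e₁`, the index-`2`
  frame projections of `kcObs` on the west bond and on the south bond of `v₀` are `-2 S₀ N₀` and
  `+2 S₀ N₀`, where `S₀ = kcS … ∅ ∅ v₀ = ⟨σ_{v₀}⟩` is the magnetisation at the source spin (CHI's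
  `E[σ_a]`): the toggle relation across the bond `{p₀ + e₀, v₀}` and the sign rule
  (`hLowSign ∅ = -1`, `vToggleSign ∅ = 1`);
* `frameCoord_slitFC_source` (recalled): those of `slitFC p₀` are `-2 N₀` and `+2 N₀`;
* **`isSHolAt_kcObs_sub_slitFC_source`**: hence `kcObs - S₀ · slitFC p₀` IS `IsSHolAt` at the
  source corner — Lemma 3.5.

Everything is proved; no named fact. NOT here: the comparison along the two (gauge-different)
branch cuts away from the source (`kcObs`'s seam is the east half-row of lower corners, `slitFC`'s
cut the diagonal `srcDY = 0`; both functions are s-holomorphic off their cuts,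
`isSHolAt_kcObs_*` / `isSHolAt_slitFC_*`).

## References

* D. Chelkak, C. Hongler, K. Izyurov, Ann. of Math. 181 (2015) = arXiv:1202.2838: Lemma 3.2,
  Lemma 3.5 [ChelkakHonglerIzyurovAnnals2015].
-/

noncomputable section

open Complex

namespace Literature.Probability.LatticeModels

section SourceMatching

open SimpleGraph

variable (G₂ : SimpleGraph (Site 2)) [G₂.LocallyFinite]

/-! ### Lattice bookkeeping around the source plaquette -/

/-- The west neighbour of `v₀ = p₀ + e₀ + e₁` is `p₀ + e₁`, its south neighbour is `p₀ + e₀`. [folklore] -/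
theorem source_neighbours (p₀ : Site 2) :
    p₀ + cornerUnit 0 + cornerUnit 1 + cornerUnit 2 = p₀ + cornerUnit 1 ∧
    p₀ + cornerUnit 0 + cornerUnit 1 + cornerUnit 3 = p₀ + cornerUnit 0 := by
  constructor <;> (ext i; fin_cases i <;> simp [cornerUnit])

/-- The plaquettes at the source: `faceAt (p₀ + e₁) 3 = p₀` (below the west bond of `v₀`),
`faceAt (p₀ + e₀) 1 = p₀` (left of the south bond), and the far endpoints are `v₀`. [folklore] -/
theorem source_faces (p₀ : Site 2) :
    faceAt (p₀ + cornerUnit 1) 3 = p₀ ∧ faceAt (p₀ + cornerUnit 0) 1 = p₀ ∧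
    p₀ + cornerUnit 1 + cornerUnit 0 = p₀ + cornerUnit 0 + cornerUnit 1 ∧
    faceAt (p₀ + cornerUnit 0) 0 = p₀ + cornerUnit 0 := by
  refine ⟨?_, ?_, ?_, ?_⟩ <;> (ext i; fin_cases i <;> simp [faceAt, cornerOff, cornerUnit])

/-- With no cut and no background spins all signs of the sign rule are `+1`:
`rowSign ∅ = 1`, `rayCountB ∅ = 0`, `vToggleSign ∅ = 1`, `hLowSign ∅ = -1`. [folklore] -/
theorem signs_empty (v : Site 2) (r : ℤ) (e : Sym2 (Site 2)) :
    rowSign ∅ r = 1 ∧ rayCountB ∅ e = 0 ∧ vToggleSign ∅ v = 1 ∧ hLowSign ∅ v = -1 := by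
  refine ⟨by simp [rowSign], by simp [rayCountB], by simp [vToggleSign, kcSign, leftCount], ?_⟩
  simp [hLowSign, rayCountB, rowSign]

/-- Index `2` of the index-`1` frame: `(a + d) N₁`. [folklore] -/
theorem re_frameCoord_kcVec1_two (a d : ℝ) : (frameCoord 0 (kcVec 0 1 a d) * (1 + I) ^ 2).re = (a + d) * frameNorm 0 1 := by
  simpa using re_frameCoord_kcVec_one 0 1 a d

variable {Λ : Finset (Site 2)} {η : SpinConfig (Site 2)} {cut : Site 2 → Finset (Sym2 (Site 2))}

/-- **The spin fermion at the source corner** (CHI Lemma 3.2 in the tree's frame, one-point case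
`B = ∅`): for a cut system with `cut p₀ = ∅` whose cut at `p₀ + e₀` is the admissible toggle of the
bond `{p₀ + e₀, v₀}`, the index-`2` projections of `kcObs` on the west and on the south bond of
`v₀ = p₀ + e₀ + e₁` are `-2 S₀ N₀` and `+2 S₀ N₀`, `S₀ = kcS … ∅ ∅ v₀ = ⟨σ_{v₀}⟩`.
[cite: ChelkakHonglerIzyurovAnnals2015, Lemma 3.2] -/
theorem frameCoord_kcObs_source (hG : ∀ v ∈ Λ, ∀ k : Fin 4, G₂.Adj v (v + cornerUnit k)) (hle : G₂ ≤ zdGraph 2)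
    (p₀ : Site 2) (h0 : cut p₀ = ∅)
    (he : s(p₀ + cornerUnit 0, p₀ + cornerUnit 0 + cornerUnit 1) ∈ edgesTouching G₂ Λ)
    (hstep : KCGaugeEquiv G₂ Λ (symmDiff (cut (faceAt (p₀ + cornerUnit 0) 1)) {s(p₀ + cornerUnit 0, p₀ + cornerUnit 0 + cornerUnit 1)})
      (cut (faceAt (p₀ + cornerUnit 0) 0))) :
    (frameCoord 0 (kcObs G₂ Λ η ∅ cut (cSrc (p₀ + cornerUnit 0 + cornerUnit 1, 2))) * (1 + I) ^ 2).re =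
        2 * (-kcS G₂ Λ criticalBetaTwo (.fixed η) ∅ ∅ (p₀ + cornerUnit 0 + cornerUnit 1)) * frameNorm 0 0 ∧
    (frameCoord 0 (kcObs G₂ Λ η ∅ cut (cTgt (p₀ + cornerUnit 0 + cornerUnit 1, 2))) * (1 + I) ^ 2).re =
        2 * kcS G₂ Λ criticalBetaTwo (.fixed η) ∅ ∅ (p₀ + cornerUnit 0 + cornerUnit 1) * frameNorm 0 0 := by
  obtain ⟨hw, hs⟩ := source_neighbours p₀
  obtain ⟨hf3, hf1, hv, hf0⟩ := source_faces p₀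
  constructor
  · -- the west bond `{p₀ + e₁, v₀}`: `d = hLowSign ∅ · kcS(cut p₀ = ∅)(v₀) = -S₀`
    simp only [cSrc]
    rw [westBond_eq, kcObs_east, hw, kcObsH, re_frameCoord_kcVec0_two, hf3, h0, hv,
      (signs_empty (p₀ + cornerUnit 1) 0 s(p₀, p₀)).2.2.2]
    ring
  · -- the south bond `{p₀ + e₀, v₀}`: toggle across it from `cut p₀ = ∅`
    simp only [cTgt, show (2 : Fin 4) + 1 = 3 from rfl]
    rw [southBond_eq, kcObs_north, hs]
    have hT : cut (faceAt (p₀ + cornerUnit 0) 1) ⊆ edgesTouching G₂ Λ := by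
      rw [hf1, h0]; exact Finset.empty_subset _
    have hsub := symmDiff_singleton_subset_edgesTouching G₂ hT he
    rw [kcObsV, re_frameCoord_kcVec1_two, vLowSign, hstep.kcS_eq G₂ hG hle hsub, kcS_toggle_vertical_top, hf1, h0,
      (signs_empty (p₀ + cornerUnit 0) ((p₀ + cornerUnit 0) 1) s(p₀, p₀)).1,
      (signs_empty (p₀ + cornerUnit 0) ((p₀ + cornerUnit 0) 1) s(p₀, p₀)).2.2.1, frameNorm_succ]
    have hs2 : Real.sqrt 2 ^ 2 = 2 := Real.sq_sqrt zero_le_two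
    linear_combination (kcS G₂ Λ criticalBetaTwo (.fixed η) ∅ ∅ (p₀ + cornerUnit 0 + cornerUnit 1) * frameNorm 0 0) * hs2

/-- **Lemma 3.5 (Chelkak–Hongler–Izyurov) in the tree's frame**: at the source corner
`(v₀, SW)` the difference `kcObs - S₀ · slitFC p₀` of the spin fermion (one-point case) and the
explicit full-plane spinor scaled by the source magnetisation `S₀ = ⟨σ_{v₀}⟩` IS s-holomorphic:
both have index-`2` projections `∓ 2 S₀ N₀` there, so the difference projects to `0` on both bonds.
[cite: ChelkakHonglerIzyurovAnnals2015, Lemma 3.5] -/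
theorem isSHolAt_kcObs_sub_slitFC_source (hG : ∀ v ∈ Λ, ∀ k : Fin 4, G₂.Adj v (v + cornerUnit k)) (hle : G₂ ≤ zdGraph 2)
    (p₀ : Site 2) (h0 : cut p₀ = ∅)
    (he : s(p₀ + cornerUnit 0, p₀ + cornerUnit 0 + cornerUnit 1) ∈ edgesTouching G₂ Λ)
    (hstep : KCGaugeEquiv G₂ Λ (symmDiff (cut (faceAt (p₀ + cornerUnit 0) 1)) {s(p₀ + cornerUnit 0, p₀ + cornerUnit 0 + cornerUnit 1)})
      (cut (faceAt (p₀ + cornerUnit 0) 0))) :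
    IsSHolAt (fun e => kcObs G₂ Λ η ∅ cut e -
      (kcS G₂ Λ criticalBetaTwo (.fixed η) ∅ ∅ (p₀ + cornerUnit 0 + cornerUnit 1) : ℂ) * slitFC p₀ e)
      (p₀ + cornerUnit 0 + cornerUnit 1, 2) := by
  set S₀ := kcS G₂ Λ criticalBetaTwo (.fixed η) ∅ ∅ (p₀ + cornerUnit 0 + cornerUnit 1) with hS₀
  have hk := frameCoord_kcObs_source G₂ (η := η) hG hle p₀ h0 he hstep
  have hf := frameCoord_slitFC_source p₀
  rw [← hS₀] at hk
  unfold IsSHolAt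
  simp only [cFace]
  rw [projLine_cornerLine_eq_iff 0 _ 2 (n := 2) (by norm_num)]
  have lin : ∀ X Y : ℂ, (frameCoord 0 (X - (S₀ : ℂ) * Y) * (1 + I) ^ 2).re =
      (frameCoord 0 X * (1 + I) ^ 2).re - S₀ * (frameCoord 0 Y * (1 + I) ^ 2).re := by
    intro X Y
    simp only [frameCoord]
    rw [show (X - (S₀ : ℂ) * Y) * (starRingEnd ℂ) (frameVec 0) * (1 + I) ^ 2 =
      X * (starRingEnd ℂ) (frameVec 0) * (1 + I) ^ 2 - (S₀ : ℂ) * (Y * (starRingEnd ℂ) (frameVec 0) * (1 + I) ^ 2) by ring,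
      Complex.sub_re, Complex.re_ofReal_mul]
  rw [lin, lin, hk.1, hk.2, hf.1, hf.2]
  ring

end SourceMatching

end Literature.Probability.LatticeModels
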